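import Mathlib.RingTheory.MvPolynomial.Homogeneous
import Mathlib.Algebra.CharP.Lemmas
import Mathlib.Data.ZMod.Basic
import Mathlib.GroupTheory.PGroup
import Summits.ValiantsHypothesis.ValiantsHypothesis.Theorems.GrenetZeonHessianRankCodimTwoLatinPermModel
import Summits.ValiantsHypothesis.ValiantsHypothesis.Theorems.GrenetZeonHessianRankCodimTwoOrbitSum
import HarnessLib

/-!
# The Latin block plane, `r = 0`: the colouring model of `permPoly` and its reduction mod `p`

Theorem P blueprint, file B (`Cruxes/HessianRankCodimTwo/GoodPlanesLatinReduction.md` §8).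
Group the permutations `σ` of `Fin (3p)` in `permPoly p = Σ_σ Π_i X_{dIdx (σ i) i}` by the
COLOURING `c = blk ∘ σ⁻¹ : Fin (3p) → Fin 3` (which column block hits each row): the summand only
depends on `c` (`colourWeight`), every colouring that occurs is BALANCED (all fibres have `p`
elements), all balanced colourings have equipotent fibres, so
`permPoly p = N • Σ_{c balanced} colourWeight c` with `N ≠ 0` (`permPoly_eq_smul_colourSum`).
The `p`-group `(ZMod p)³` of cyclic shifts inside the row blocks acts on balanced colourings
preserving the weight; its fixed points are the colourings constant on blocks, i.e. `κ ∘ blk` for a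
permutation `κ` of `Fin 3`, so modulo `p` (weighted orbit counting, `…OrbitSum.lean`)
`Σ_{balanced} colourWeight ≡ Σ_{κ ∈ S₃} Π_I X_{κ I − I}^p = (per circ(X₀,X₁,X₂))^p`
(`map_colourSum_eq_pow`).
-/

noncomputable section

open MvPolynomial Finset
open Literature.Computability.AlgebraicComplexity

-- single-conjunct layout `Summits/ValiantsHypothesis/ValiantsHypothesis`: duplicated namespace by design
set_option linter.dupNamespace false

namespace Summit.ValiantsHypothesis.ValiantsHypothesis.Theorems.GrenetZeonHessianRankCodimTwo

variable {p : ℕ}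

/-! ### Blocks and colourings -/

/-- The block of an index of `Fin (3p)` (total: reduced mod `3`, which is the identity on the
actual range `i / p < 3`). [folklore] -/
def blk (p : ℕ) (i : Fin (3 * p + 0)) : Fin 3 := ⟨(i.val / p) % 3, Nat.mod_lt _ (by norm_num)⟩

/-- The weight of a colouring `c : Fin (3p) → Fin 3`: `Π_r X_{(c r + 2·blk r) mod 3}`. [folklore] -/
def colourWeight (p : ℕ) (c : Fin (3 * p + 0) → Fin 3) : MvPolynomial (Fin 3) ℤ :=
  ∏ r, X ⟨(c r + 2 * (blk p r).val) % 3, Nat.mod_lt _ (by norm_num)⟩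

/-- The colouring of a permutation: which (column) block is sent to each row. [folklore] -/
def colourOf (p : ℕ) (σ : Equiv.Perm (Fin (3 * p + 0))) : Fin (3 * p + 0) → Fin 3 :=
  fun r => blk p (σ.symm r)

/-- The sum of the weights of the balanced colourings. [folklore] -/
def colourSum (p : ℕ) : MvPolynomial (Fin 3) ℤ :=
  ∑ c ∈ Finset.univ.filter (fun c : Fin (3 * p + 0) → Fin 3 =>
    ∀ J : Fin 3, (Finset.univ.filter fun r => c r = J).card = p), colourWeight p c

/-- The block of `i` is `i / p`. [folklore] -/
theorem blk_val (hp : 0 < p) (i : Fin (3 * p + 0)) : (blk p i).val = i.val / p := by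
  have hi : i.val / p < 3 := (Nat.div_lt_iff_lt_mul hp).mpr (by have := i.isLt; omega)
  simp [blk, Nat.mod_eq_of_lt hi]

/-- The summand of `permPoly` only depends on the colouring. [folklore] -/
theorem prod_X_dIdx_eq_colourWeight (hp : 0 < p) (σ : Equiv.Perm (Fin (3 * p + 0))) :
    ∏ i, (X (dIdx p (σ i) i) : MvPolynomial (Fin 3) ℤ) = colourWeight p (colourOf p σ) := by
  unfold colourWeight
  -- reindex the product by `r = σ i`
  rw [← Equiv.prod_comp σ.symm (fun i => (X (dIdx p (σ i) i) : MvPolynomial (Fin 3) ℤ))]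
  refine Finset.prod_congr rfl fun r _ => ?_
  congr 1
  apply Fin.ext
  simp only [dIdx, colourOf, Equiv.apply_symm_apply, blk_val hp]

/-- The block map is a balanced colouring. [folklore] -/
theorem balanced_blk (hp : 0 < p) (J : Fin 3) :
    (Finset.univ.filter fun r => blk p r = J).card = p := by
  -- the block `J` is the image of `Fin p` under `s ↦ J*p + s`
  have hJ := J.isLt
  let f : Fin p → Fin (3 * p + 0) := fun s => ⟨J.val * p + s.val, by have := s.isLt; nlinarith⟩
  have hf : Function.Injective f := by
    intro s s' h
    have := congr_arg Fin.val h
    simp only [f] at this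
    exact Fin.ext (by omega)
  have himg : Finset.univ.filter (fun r => blk p r = J) = Finset.univ.image f := by
    ext r
    simp only [Finset.mem_filter, Finset.mem_univ, true_and, Finset.mem_image, f]
    constructor
    · intro h
      have hv : r.val / p = J.val := by rw [← blk_val hp r, h]
      refine ⟨⟨r.val % p, Nat.mod_lt _ hp⟩, Fin.ext ?_⟩
      simp only
      have := Nat.div_add_mod r.val p
      rw [hv] at this
      linarith [Nat.mul_comm p J.val]
    · rintro ⟨s, rfl⟩
      apply Fin.ext
      rw [blk_val hp]
      simp only
      rw [show J.val * p + s.val = s.val + p * J.val by ring, Nat.add_mul_div_left _ _ hp,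
        Nat.div_eq_of_lt s.isLt, zero_add]
  rw [himg, Finset.card_image_of_injective _ hf, Finset.card_univ, Fintype.card_fin]

/-- The colouring of a permutation is balanced. [folklore] -/
theorem balanced_colourOf (hp : 0 < p) (σ : Equiv.Perm (Fin (3 * p + 0))) (J : Fin 3) :
    (Finset.univ.filter fun r => colourOf p σ r = J).card = p := by
  calc (Finset.univ.filter fun r => colourOf p σ r = J).card
      = (Finset.univ.filter fun i => blk p i = J).card := by
        refine Finset.card_bij (fun r _ => σ.symm r) (fun r hr => ?_) (fun r _ r' _ h => ?_)
          (fun i hi => ?_)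
        · simpa [colourOf] using hr
        · exact σ.symm.injective h
        · refine ⟨σ i, ?_, by simp⟩
          simpa [colourOf] using hi
    _ = p := balanced_blk hp J

/-- A balanced colouring is the colouring of some permutation. [folklore] -/
theorem exists_perm_colourOf_eq (hp : 0 < p) {c : Fin (3 * p + 0) → Fin 3}
    (hc : ∀ J : Fin 3, (Finset.univ.filter fun r => c r = J).card = p) :
    ∃ ρ : Equiv.Perm (Fin (3 * p + 0)), colourOf p ρ = c := by
  classical
  -- fibrewise bijections `{r // c r = J} ≃ {i // blk i = J}`
  have hcard : ∀ J, Fintype.card {r // c r = J} = Fintype.card {i // blk p i = J} := by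
    intro J
    rw [Fintype.card_subtype, Fintype.card_subtype, hc J, balanced_blk hp J]
  let e : (J : Fin 3) → {r // c r = J} ≃ {i // blk p i = J} := fun J => Fintype.equivOfCardEq (hcard J)
  -- glue: `Fin (3p) ≃ Σ J, {r // c r = J} ≃ Σ J, {i // blk i = J} ≃ Fin (3p)`
  let ρinv : Fin (3 * p + 0) ≃ Fin (3 * p + 0) :=
    ((Equiv.sigmaFiberEquiv c).symm.trans (Equiv.sigmaCongrRight e)).trans
      (Equiv.sigmaFiberEquiv (blk p))
  have hρ : ∀ r, blk p (ρinv r) = c r := by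
    intro r
    simp only [ρinv, Equiv.trans_apply, Equiv.sigmaCongrRight_apply, Equiv.sigmaFiberEquiv_apply]
    exact (e (c r) ⟨r, rfl⟩).2
  refine ⟨ρinv.symm, funext fun r => ?_⟩
  simp only [colourOf, Equiv.symm_symm, hρ]

/-- All balanced colourings have equipotent fibres under `colourOf`. [folklore] -/
theorem card_fibre_colourOf_eq (hp : 0 < p) {c : Fin (3 * p + 0) → Fin 3}
    (hc : ∀ J : Fin 3, (Finset.univ.filter fun r => c r = J).card = p) :
    (Finset.univ.filter fun σ : Equiv.Perm (Fin (3 * p + 0)) => colourOf p σ = c).card =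
      (Finset.univ.filter fun σ : Equiv.Perm (Fin (3 * p + 0)) => colourOf p σ = blk p).card := by
  obtain ⟨ρ, hρ⟩ := exists_perm_colourOf_eq hp hc
  -- `σ ↦ ρ⁻¹ * σ` maps the fibre of `c` onto the fibre of `blk`
  refine Finset.card_bij (fun σ _ => ρ⁻¹ * σ) (fun σ hσ => ?_) (fun σ _ σ' _ h => ?_)
    (fun τ hτ => ?_)
  · simp only [Finset.mem_filter, Finset.mem_univ, true_and] at hσ ⊢
    funext r
    have h1 : colourOf p (ρ⁻¹ * σ) r = colourOf p σ (ρ r) := by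
      simp [colourOf, Equiv.Perm.mul_def, Equiv.Perm.inv_def]
    rw [h1, hσ, ← hρ]
    simp [colourOf]
  · exact mul_left_cancel h
  · simp only [Finset.mem_filter, Finset.mem_univ, true_and] at hτ
    refine ⟨ρ * τ, ?_, by group⟩
    simp only [Finset.mem_filter, Finset.mem_univ, true_and]
    funext r
    have h1 : colourOf p (ρ * τ) r = colourOf p τ (ρ.symm r) := by
      simp [colourOf, Equiv.Perm.mul_def]
    rw [h1, hτ, ← hρ]
    simp [colourOf]

/-- **The colouring model of the permanent polynomial**: `permPoly p = N • colourSum p` with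
`N = #{σ : colourOf σ = blk} ≥ 1`. [folklore] -/
theorem permPoly_eq_smul_colourSum (hp : 0 < p) :
    permPoly p = (Finset.univ.filter fun σ : Equiv.Perm (Fin (3 * p + 0)) =>
      colourOf p σ = blk p).card • colourSum p := by
  classical
  unfold permPoly colourSum
  rw [Finset.sum_congr rfl fun σ _ => prod_X_dIdx_eq_colourWeight hp σ,
    Finset.sum_comp (colourWeight p) (colourOf p), Finset.smul_sum]
  -- the image of `colourOf` is the set of balanced colourings
  have himg : Finset.univ.image (colourOf p) = Finset.univ.filter
      (fun c : Fin (3 * p + 0) → Fin 3 => ∀ J : Fin 3, (Finset.univ.filter fun r => c r = J).card = p) := by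
    ext c
    simp only [Finset.mem_image, Finset.mem_univ, true_and, Finset.mem_filter]
    constructor
    · rintro ⟨σ, rfl⟩; exact balanced_colourOf hp σ
    · exact fun hc => exists_perm_colourOf_eq hp hc
  rw [himg]
  refine Finset.sum_congr rfl fun c hc => ?_
  rw [card_fibre_colourOf_eq hp (Finset.mem_filter.mp hc).2]

/-- The multiplicity `N` is positive (the identity permutation has colouring `blk`). [folklore] -/
theorem card_fibre_blk_pos :
    0 < (Finset.univ.filter fun σ : Equiv.Perm (Fin (3 * p + 0)) => colourOf p σ = blk p).card :=
  Finset.card_pos.mpr ⟨1, by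
    simp only [Finset.mem_filter, Finset.mem_univ, true_and]
    funext r
    change blk p ((Equiv.refl _).symm r) = blk p r
    rfl⟩

end Summit.ValiantsHypothesis.ValiantsHypothesis.Theorems.GrenetZeonHessianRankCodimTwo
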